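import Literature.NumberTheory.Automorphic.SymplecticSatakeOrbitSumBasis
import HarnessLib

/-!
# Unitriangularity of the Cartan operators of `Sp_{2n}` in the orbit-sum basis: `𝒮_1(T_{d(a)}) = S_a + ∑_{λ ≠ a} n_a(λ) S_λ`
# over every commutative ring `R` (Henniart–Vignéras §7.14; Gross (3.10)–(3.11); Bruhat–Tits (4.4.4))

Topic `NumberTheory/Automorphic`; namespace `Literature.NumberTheory.Automorphic.SymplecticCartan` (lane `lit-hodgefound`,
Track 2 foundations; seat `lit-hodgefound-p11`, generation 50, row g50-#13).  THEOREMS ONLY: no definition, no named fact, no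
instance, no notation.  A rider to g50-#11 (`SymplecticSatakeOrbitSumBasis`): the `Sp_{2n}` analogue of
`HyperspecialSatakeOrbitSumTriangular` (g49-#13).

## The print and the mathematics

[HenniartVigneras2013] §7.14: «For `λ ∈ Λ⁻` write `E_λ` for the characteristic function of `KzK` when `z` has image `λ`. […]
`S_ℤ(E_λ) = S_λ + Φ_λ` where `Φ_λ` is a `ℤ`-linear combination of `S_μ` with `μ` in `Λ⁻(r)`»; [GrossSatake1998] (3.10)–(3.11):
«If one takes the scaled basis `φ_λ = q^{⟨λ,ρ⟩} χ_λ` […] one finds that `S(c_λ) = φ_λ + ∑_{μ<λ} b_λ(μ) φ_μ` with coefficients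
`b_λ(μ)` in `ℤ`».

HERE, for the Cartan operator `T_{d(a)} = 𝟙_{K₀ d(a) K₀}`, `d(a) = diag(ϖ^a; ϖ^{-a})`, `a ∈ ℕⁿ` antitone (the tree's dominant
indexing), in `ℋ(Sp_{2n}(K), Sp_{2n}(𝒪); R)` over EVERY commutative ring `R`: the counting coefficients are the natural numbers
`n_a(μ) = #{γ ⊆ K₀ d(a) K₀ : a(γ) = μ}` (`coeff_symplecticSatakeTransform_one_doubleCosetOperator`), and
`𝒮_1(T_{d(a)}) = S_a + ∑_λ n_a(λ) S_λ`, the sum over the dominant `λ ≠ a` in the support of `𝒮_1(T_{d(a)})` — all of which lie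
dominance-BELOW `a` (`∑_{i<r} λ_i ≤ ∑_{i<r} a_i`, Bruhat–Tits (4.4.4) (i), `headSum_le_of_coeff_symplecticSatakeTransform_ne_zero`) —;
the coefficient of `S_a` is `1` because exactly one coset of `K₀ d(a) K₀` has exponents `a` (Bruhat–Tits (4.4.4) (ii),
`coeff_self_symplecticSatakeTransform_cartanDiagonal`).  Proof: expand `𝒮_1(T_{d(a)}) ∈ 𝒯_R(q)` in the orbit-sum basis (g50-#11
`eq_sum_coeff_smul_symplecticTwistedOrbitSum_of_mem`) and split off the term at `a`.  When `q = 0` in `R` the orbit sums are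
monomials: `𝒮_1(T_{d(a)}) = x^a + ∑_λ n_a(λ) x^λ`.

## What is formalised (theorems only)

* `coeff_symplecticSatakeTransform_one_doubleCosetOperator` (`𝒮_1(T_g)_μ = n_g(μ)`),
  **`symplecticSatakeTransform_one_cartan_eq_twistedOrbitSum_add`**, `ne_and_headSum_le_of_mem_erase_support_symplectic`
  (the index set: dominant `λ ≠ a` dominance-below `a`), `symplecticSatakeTransform_one_cartan_eq_single_add_of_cast_eq_zero`.

## References
* [HenniartVigneras2013] G. Henniart, M.-F. Vignéras, *A Satake isomorphism for representations modulo p of reductive groups over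
  local fields*, J. reine angew. Math. 701 (2015), §6.10, §7.14, §7.15 Remark 1.
* [GrossSatake1998] B. H. Gross, *On the Satake isomorphism* (1998), (3.9)–(3.11).
* [BruhatTits1972] F. Bruhat, J. Tits, *Groupes réductifs sur un corps local I*, Publ. Math. IHÉS 41 (1972), Prop. (4.4.4).
-/

noncomputable section

open scoped Valued WithZero MatrixGroups
open Matrix MonoidAlgebra Representation

namespace Literature.NumberTheory.Automorphic.SymplecticCartan

open Literature.NumberTheory.Automorphic Literature.NumberTheory.Automorphic.CartanUnique

variable {R : Type*} [CommRing R] {n : ℕ}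
variable {K : Type*} [Field K] [Valued K ℤᵐ⁰] {ϖ : K} [CompactSpace 𝒪[K]] [Finite 𝓀[K]]
  [IsHeckeTriple (⊤ : Submonoid (symplecticGroup (Fin n) K)) (symplecticInt (Fin n) K) (symplecticInt (Fin n) K)]

omit [CompactSpace 𝒪[K]] [Finite 𝓀[K]] in
/-- **The counting coefficients are coset counts**: `𝒮_1(T_g)_μ = n_g(μ) = #{γ ⊆ K₀gK₀ : a(γ) = μ}` (cast to `R`).
[cite: HenniartVigneras2013, §7.14] [cite: CartierCorvallis1979, §IV (4.2)] -/
theorem coeff_symplecticSatakeTransform_one_doubleCosetOperator (hϖ : Valued.v ϖ = WithZero.exp (-1 : ℤ))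
    (g : symplecticGroup (Fin n) K) (μ : Fin n → ℤ)
    [DecidablePred fun α : symplecticGroup (Fin n) K ⧸ symplecticInt (Fin n) K => symplecticIwasawaExp hϖ α.out = μ] :
    (symplecticSatakeTransform hϖ (1 : Rˣ) (heckeAlgebra.doubleCosetOperator (symplecticInt (Fin n) K) g)).coeff μ =
      (((finite_orbit_quotient (symplecticInt (Fin n) K) g).toFinset.filter fun α => symplecticIwasawaExp hϖ α.out = μ).card : R) := by
  rw [coeff_symplecticSatakeTransform_doubleCosetOperator, _root_.one_zpow, Units.val_one, mul_one]

/-- **`𝒮_1(T_{d(a)}) = S_a + ∑_{λ ≠ a} n_a(λ) S_λ` IN `ℋ(Sp_{2n}(K), Sp_{2n}(𝒪); R)`, EVERY COMMUTATIVE RING `R`**: the counting transform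
of the Cartan operator of an antitone `a ∈ ℕⁿ`, expanded in the orbit-sum basis of g50-#11, has coefficient `1` at `S_a`; the other
indices are the dominant `λ ≠ a` in the support of `𝒮_1(T_{d(a)})`, with coefficients the coset counts `n_a(λ)`.
[cite: HenniartVigneras2013, §7.14] [cite: GrossSatake1998, (3.10)–(3.11)] [cite: BruhatTits1972, Prop. (4.4.4) (ii)] -/
theorem symplecticSatakeTransform_one_cartan_eq_twistedOrbitSum_add (hϖ : Valued.v ϖ = WithZero.exp (-1 : ℤ))
    {a : Fin n → ℕ} (ha : Antitone a) :
    symplecticSatakeTransform hϖ (1 : Rˣ) (heckeAlgebra.doubleCosetOperator (symplecticInt (Fin n) K)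
        (⟨Matrix.diagonal (Sum.elim (fun i => ϖ ^ a i) (fun i => (ϖ ^ a i)⁻¹)),
          diagonal_pow_mem_symplecticGroup (CartanUnique.uniformizer_ne_zero hϖ) a⟩ : symplecticGroup (Fin n) K)) =
      symplecticTwistedOrbitSum R n (Nat.card 𝓀[K]) (fun i => (a i : ℤ)) +
        ∑ la ∈ ((symplecticSatakeTransform hϖ (1 : Rˣ) (heckeAlgebra.doubleCosetOperator (symplecticInt (Fin n) K)
            (⟨Matrix.diagonal (Sum.elim (fun i => ϖ ^ a i) (fun i => (ϖ ^ a i)⁻¹)),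
              diagonal_pow_mem_symplecticGroup (CartanUnique.uniformizer_ne_zero hϖ) a⟩ : symplecticGroup (Fin n) K))).coeff.support.filter
            (fun la => Antitone la ∧ ∀ i, 0 ≤ la i)).erase (fun i => (a i : ℤ)),
          (symplecticSatakeTransform hϖ (1 : Rˣ) (heckeAlgebra.doubleCosetOperator (symplecticInt (Fin n) K)
            (⟨Matrix.diagonal (Sum.elim (fun i => ϖ ^ a i) (fun i => (ϖ ^ a i)⁻¹)),
              diagonal_pow_mem_symplecticGroup (CartanUnique.uniformizer_ne_zero hϖ) a⟩ : symplecticGroup (Fin n) K))).coeff la •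
            symplecticTwistedOrbitSum R n (Nat.card 𝓀[K]) la := by
  classical
  set F := symplecticSatakeTransform hϖ (1 : Rˣ) (heckeAlgebra.doubleCosetOperator (symplecticInt (Fin n) K)
    (⟨Matrix.diagonal (Sum.elim (fun i => ϖ ^ a i) (fun i => (ϖ ^ a i)⁻¹)),
      diagonal_pow_mem_symplecticGroup (CartanUnique.uniformizer_ne_zero hϖ) a⟩ : symplecticGroup (Fin n) K)) with hF
  have haZ : Antitone (fun i => (a i : ℤ)) ∧ ∀ i, 0 ≤ ((a i : ℤ)) :=
    ⟨fun _ _ hij => Int.ofNat_le.2 (ha hij), fun i => Int.natCast_nonneg (a i)⟩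
  have hF1 : F.coeff (fun i => (a i : ℤ)) = 1 := by
    rw [hF, coeff_self_symplecticSatakeTransform_cartanDiagonal hϖ (1 : Rˣ) ha, _root_.one_zpow, Units.val_one]
  have hexp := eq_sum_coeff_smul_symplecticTwistedOrbitSum_of_mem (symplecticSatakeTransform_one_mem_twisted hϖ
    (heckeAlgebra.doubleCosetOperator (k := R) (symplecticInt (Fin n) K)
      (⟨Matrix.diagonal (Sum.elim (fun i => ϖ ^ a i) (fun i => (ϖ ^ a i)⁻¹)),
        diagonal_pow_mem_symplecticGroup (CartanUnique.uniformizer_ne_zero hϖ) a⟩ : symplecticGroup (Fin n) K)))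
  rw [← hF] at hexp
  by_cases hcs : (fun i => (a i : ℤ)) ∈ F.coeff.support.filter (fun la => Antitone la ∧ ∀ i, 0 ≤ la i)
  · conv_lhs => rw [hexp]
    rw [← Finset.add_sum_erase _ _ hcs, hF1, one_smul]
  · -- degenerate case `1 = 0` in `R`
    have h10 : (1 : R) = 0 := by
      by_contra h
      exact hcs (Finset.mem_filter.2 ⟨Finsupp.mem_support_iff.2 (by rw [hF1]; exact h), haZ⟩)
    have h0 : symplecticTwistedOrbitSum R n (Nat.card 𝓀[K]) (fun i => (a i : ℤ)) = 0 := by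
      rw [← one_smul R (symplecticTwistedOrbitSum R n (Nat.card 𝓀[K]) (fun i => (a i : ℤ))), h10, zero_smul]
    rw [h0, zero_add, Finset.erase_eq_of_notMem hcs]
    exact hexp

omit [CompactSpace 𝒪[K]] [Finite 𝓀[K]] in
/-- The indices of the expansion: dominant `λ ≠ a` lying dominance-BELOW `a` (`∑_{i<r} λ_i ≤ ∑_{i<r} a_i` for all `r`).
[cite: HenniartVigneras2013, §6.10, §7.14] [cite: BruhatTits1972, Prop. (4.4.4) (i)] -/
theorem ne_and_headSum_le_of_mem_erase_support_symplectic (hϖ : Valued.v ϖ = WithZero.exp (-1 : ℤ)) {a : Fin n → ℕ}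
    (ha : Antitone a) {la : Fin n → ℤ}
    (hla : la ∈ ((symplecticSatakeTransform hϖ (1 : Rˣ) (heckeAlgebra.doubleCosetOperator (symplecticInt (Fin n) K)
        (⟨Matrix.diagonal (Sum.elim (fun i => ϖ ^ a i) (fun i => (ϖ ^ a i)⁻¹)),
          diagonal_pow_mem_symplecticGroup (CartanUnique.uniformizer_ne_zero hϖ) a⟩ : symplecticGroup (Fin n) K))).coeff.support.filter
        (fun la => Antitone la ∧ ∀ i, 0 ≤ la i)).erase (fun i => (a i : ℤ))) :
    la ≠ (fun i => (a i : ℤ)) ∧ (Antitone la ∧ ∀ i, 0 ≤ la i) ∧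
      ∀ r : ℕ, (∑ i : Fin n, if (i : ℕ) < r then la i else 0) ≤ ∑ i : Fin n, if (i : ℕ) < r then (a i : ℤ) else 0 := by
  obtain ⟨hne, hla'⟩ := Finset.mem_erase.1 hla
  obtain ⟨hsupp, hdom⟩ := Finset.mem_filter.1 hla'
  exact ⟨hne, hdom, fun r => headSum_le_of_coeff_symplecticSatakeTransform_ne_zero hϖ 1 ha (Finsupp.mem_support_iff.1 hsupp) r⟩

/-- **`𝒮_1(T_{d(a)}) = x^a + ∑_{λ ≠ a} n_a(λ) x^λ` when `q = 0` in `R`** (the orbit sums are monomials, g50-#11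
`symplecticTwistedOrbitSum_of_cast_eq_zero`). [cite: HenniartVigneras2013, §7.14, §7.15 Remark 1] [cite: BruhatTits1972, Prop. (4.4.4)] -/
theorem symplecticSatakeTransform_one_cartan_eq_single_add_of_cast_eq_zero (hϖ : Valued.v ϖ = WithZero.exp (-1 : ℤ))
    (hq : ((Nat.card 𝓀[K] : ℕ) : R) = 0) {a : Fin n → ℕ} (ha : Antitone a) :
    symplecticSatakeTransform hϖ (1 : Rˣ) (heckeAlgebra.doubleCosetOperator (symplecticInt (Fin n) K)
        (⟨Matrix.diagonal (Sum.elim (fun i => ϖ ^ a i) (fun i => (ϖ ^ a i)⁻¹)),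
          diagonal_pow_mem_symplecticGroup (CartanUnique.uniformizer_ne_zero hϖ) a⟩ : symplecticGroup (Fin n) K)) =
      AddMonoidAlgebra.single (fun i => (a i : ℤ)) (1 : R) +
        ∑ la ∈ ((symplecticSatakeTransform hϖ (1 : Rˣ) (heckeAlgebra.doubleCosetOperator (symplecticInt (Fin n) K)
            (⟨Matrix.diagonal (Sum.elim (fun i => ϖ ^ a i) (fun i => (ϖ ^ a i)⁻¹)),
              diagonal_pow_mem_symplecticGroup (CartanUnique.uniformizer_ne_zero hϖ) a⟩ : symplecticGroup (Fin n) K))).coeff.support.filter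
            (fun la => Antitone la ∧ ∀ i, 0 ≤ la i)).erase (fun i => (a i : ℤ)),
          (symplecticSatakeTransform hϖ (1 : Rˣ) (heckeAlgebra.doubleCosetOperator (symplecticInt (Fin n) K)
            (⟨Matrix.diagonal (Sum.elim (fun i => ϖ ^ a i) (fun i => (ϖ ^ a i)⁻¹)),
              diagonal_pow_mem_symplecticGroup (CartanUnique.uniformizer_ne_zero hϖ) a⟩ : symplecticGroup (Fin n) K))).coeff la •
            AddMonoidAlgebra.single la (1 : R) := by
  have haZ : Antitone (fun i => (a i : ℤ)) ∧ ∀ i, 0 ≤ ((a i : ℤ)) :=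
    ⟨fun _ _ hij => Int.ofNat_le.2 (ha hij), fun i => Int.natCast_nonneg (a i)⟩
  conv_lhs => rw [symplecticSatakeTransform_one_cartan_eq_twistedOrbitSum_add hϖ ha]
  rw [symplecticTwistedOrbitSum_of_cast_eq_zero hq haZ]
  congr 1
  refine Finset.sum_congr rfl fun la hla => ?_
  obtain ⟨-, hla'⟩ := Finset.mem_erase.1 hla
  rw [symplecticTwistedOrbitSum_of_cast_eq_zero hq (Finset.mem_filter.1 hla').2]

end Literature.NumberTheory.Automorphic.SymplecticCartan

end
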